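import Summits.AtomisticToContinuum.HydrodynamicLimit.Theorems.BoxDissipativeWeakStrongRelativeEnergyStabilityCoercivePointwise
import Summits.AtomisticToContinuum.HydrodynamicLimit.Theorems.BoxDissipativeWeakStrongRelativeEnergyStabilityCoerciveBoxHelpers
import Summits.AtomisticToContinuum.HydrodynamicLimit.Theorems.BoxDissipativeWeakStrongRelativeEnergyStabilityCoerciveTestHelpers
import HarnessLib

/-!
# Crux `RelativeEnergyStability` (stmt-AtomisticToContinuum-17653), line `registered`:
stub `stub_clampedRelEnergyCoercive` (S3')

**S3' — the clamped box relative energy is coercive.** In the line's currency, the mean CLAMPED box relative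
energy `E_{P_N} ofReal(∫ ℰ_{Z_{a,b}}(Û_N(t,x) | (ρ,u,θ)(t,x)) dx)` (`RES.BoxClampedRelEnergyVanishesAt`, Březina–
Feireisl's `relEnergyZ` of the cut hard-sphere law with a deep lower clamp) vanishing at a time `t ∈ [0,T)`
forces convergence in probability of the tested empirical density, momentum and energy fields of the evolved
configurations to `(ρ, ρu, E)(t)` (`TendstoHydroFieldsAt`). Proof (`stub_clampedRelEnergyCoercive`):

1. pointwise coercivity (`co_pointwise_estimate`): `dev(Û | (ρ,u,θ)(t,x)) ≤ ε + K'(ε) ℰ_Z` for every admissible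
   box state, the frozen states (`Ê = |m̂|²/(2ρ̂)`, Lean junk `log 0 = 0`) being admitted only below a density
   threshold `ρs`;
2. admissibility almost surely (`co_box_admissible`, `co_ae_distinctVel`): under the local Gibbs law, at
   every time, the evolved configuration has pairwise distinct velocities (hyperplanes are Liouville-null, the
   flow preserves Liouville, `P_N ≪ Liouville`), so a frozen box holds one particle and has density
   `((N+1)ℓ_N³)⁻¹ ≤ ρs` eventually (kinetic window);
3. integration in `x` and in `P_N` (`co_pathwise_integral_le`; `ℰ_Z` is `x`-integrable,
   `co_integrable_clampedRelEnergy`): `E ofReal(∫ dev dx) ≤ ofReal ε + ofReal K' · E ofReal(∫ ℰ_Z dx)`, so the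
   `L¹(P_N ⊗ dx)` box deviation tends to `0` (`co_tendsto_zero_of_le`);
4. read-out (`co_abs_density_dev_le` &c.): each tested deviation is `≤ ω_χ(ℓ_N/2)(1 + |∫E| + D) + ‖χ‖_∞ D`,
   `D = ∫ dev dx`, and Markov with the a.s. domination (`co_tendsto_measure_of_le`) concludes.

References: BrezinaFeireisl2018 §3.1–3.2; FeireislNovotny2012 §3; Spohn1991 Part I Ch. 3;
OllaVaradhanYau1993 §1.
-/

noncomputable section

namespace Summit.AtomisticToContinuum.HydrodynamicLimit.Theorems.RES

open MeasureTheory Filter Set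
open scoped ENNReal Topology
open Summit.AtomisticToContinuum.HydrodynamicLimit.Theses.BoxDissipativeWeakStrong
open Literature.MathematicalPhysics.KineticTheory Literature.Analysis.FluidPDE
open Literature.Analysis.FluidPDE.CompressibleEuler
open Literature.Analysis.FluidPDE.CompressibleEuler.EulerPhase

/-! ## Pathwise integration of the pointwise estimate -/

/-- **Integrating the pointwise estimate over the torus for one admissible configuration**: if every
admissible box state obeys `dev ≤ ε + K' ℰ_Z`, a configuration `w` with pairwise distinct velocities and
one-particle density `((N+1)ℓ³)⁻¹ ≤ ρs` satisfies `∫ dev dx ≤ ε + K' ∫ ℰ_Z dx`. -/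
theorem co_pathwise_integral_le {σ η₁ a b l ε K' ρs : ℝ} {N : ℕ} {r₀ θ₀ : T3 → ℝ} {u₀ : T3 → V3}
    (hl : 0 < l) (hr : Continuous r₀) (hu : Continuous u₀) (hθ : Continuous θ₀)
    (hμC : Continuous fun x => (cutEOS σ η₁).chemPotential (r₀ x) (θ₀ x))
    (hpC : Continuous fun x => (cutEOS σ η₁).p (r₀ x) (θ₀ x))
    (hpt : ∀ (x : T3) (U : BoxState), 0 ≤ U.1 → (U.1 = 0 → U.2.1 = 0 ∧ U.2.2 = 0) →
      0 ≤ U.2.2 - ‖U.2.1‖ ^ 2 / (2 * U.1) →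
      (0 < U.1 → U.2.2 - ‖U.2.1‖ ^ 2 / (2 * U.1) = 0 → U.1 ≤ ρs) →
        0 ≤ clampedRelEnergy σ η₁ a b (r₀ x) (u₀ x) (θ₀ x) U ∧
        |U.1 - r₀ x| + ‖U.2.1 - r₀ x • u₀ x‖ + |U.2.2 - totalEnergyDensity (r₀ x) (u₀ x) (θ₀ x)| ≤
          ε + K' * clampedRelEnergy σ η₁ a b (r₀ x) (u₀ x) (θ₀ x) U)
    (w : Config (N + 1) (Fin 3) T3) (hdist : ∀ i j, i ≠ j → (w i).2 ≠ (w j).2)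
    (hN : ((N : ℝ) + 1)⁻¹ * (l ^ 3)⁻¹ ≤ ρs) :
    ∫ x, (|empiricalDensityField w (boxKernel l x) - r₀ x| +
        ‖empiricalMomentumField w (boxKernel l x) - r₀ x • u₀ x‖ +
        |empiricalEnergyField w (boxKernel l x) - totalEnergyDensity (r₀ x) (u₀ x) (θ₀ x)|) ≤
      ε + K' * ∫ x, clampedRelEnergy σ η₁ a b (r₀ x) (u₀ x) (θ₀ x) (boxState l w x) := by
  have hE : Continuous fun x => totalEnergyDensity (r₀ x) (u₀ x) (θ₀ x) := by
    unfold totalEnergyDensity; fun_prop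
  have hdev := tz_integrable_dev w hl.le (f₂ := fun x => r₀ x • u₀ x) hr (hr.smul hu) hE
  have hZ := co_integrable_clampedRelEnergy (a := a) (b := b) (l := l) hu hθ hμC hpC w
  have hpt' : ∀ x, |empiricalDensityField w (boxKernel l x) - r₀ x| +
      ‖empiricalMomentumField w (boxKernel l x) - r₀ x • u₀ x‖ +
      |empiricalEnergyField w (boxKernel l x) - totalEnergyDensity (r₀ x) (u₀ x) (θ₀ x)| ≤
        ε + K' * clampedRelEnergy σ η₁ a b (r₀ x) (u₀ x) (θ₀ x) (boxState l w x) := by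
    intro x
    obtain ⟨h1, h2, h3, h4⟩ := co_box_admissible hl.le w hdist x
    exact (hpt x (boxState l w x) h1 h2 h3 fun hp he => (h4 hp he).trans hN).2
  calc ∫ x, (|empiricalDensityField w (boxKernel l x) - r₀ x| +
        ‖empiricalMomentumField w (boxKernel l x) - r₀ x • u₀ x‖ +
        |empiricalEnergyField w (boxKernel l x) - totalEnergyDensity (r₀ x) (u₀ x) (θ₀ x)|)
      ≤ ∫ x, (ε + K' * clampedRelEnergy σ η₁ a b (r₀ x) (u₀ x) (θ₀ x) (boxState l w x)) :=
        integral_mono hdev ((integrable_const ε).add (hZ.const_mul K')) hpt'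
    _ = ε + K' * ∫ x, clampedRelEnergy σ η₁ a b (r₀ x) (u₀ x) (θ₀ x) (boxState l w x) := by
        rw [integral_add (integrable_const ε) (hZ.const_mul K'), integral_const, integral_const_mul]
        simp

/-! ## Two limit lemmas -/

/-- If `f_N ≤ ε + K_ε A_N` eventually for every `ε > 0` with `K_ε < ∞` and `A_N → 0`, then `f_N → 0`. -/
theorem co_tendsto_zero_of_le {f A : ℕ → ℝ≥0∞} (hA : Tendsto A atTop (𝓝 0))
    (h : ∀ ε : ℝ, 0 < ε → ∃ K : ℝ≥0∞, K ≠ ∞ ∧ ∀ᶠ N in atTop, f N ≤ ENNReal.ofReal ε + K * A N) :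
    Tendsto f atTop (𝓝 0) := by
  -- adapted from `tz_tendsto_zero_of_le` (…RelativeEnergyStabilityTimeZero.lean), with an eventual bound
  rw [ENNReal.tendsto_atTop_zero]
  intro ε hε
  by_cases htop : ε = ∞
  · exact ⟨0, fun n _ => htop ▸ le_top⟩
  have he : 0 < ε.toReal := ENNReal.toReal_pos hε.ne' htop
  obtain ⟨K, hK, hf⟩ := h (ε.toReal / 2) (half_pos he)
  have hKA : Tendsto (fun N => K * A N) atTop (𝓝 0) := by
    simpa using ENNReal.Tendsto.const_mul hA (Or.inr hK)
  obtain ⟨N₀, hN₀⟩ := ENNReal.tendsto_atTop_zero.1 hKA (ENNReal.ofReal (ε.toReal / 2))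
    (by simpa using half_pos he)
  obtain ⟨N₁, hN₁⟩ := eventually_atTop.1 hf
  refine ⟨max N₀ N₁, fun n hn => (hN₁ n (le_of_max_le_right hn)).trans ?_⟩
  calc ENNReal.ofReal (ε.toReal / 2) + K * A n
      ≤ ENNReal.ofReal (ε.toReal / 2) + ENNReal.ofReal (ε.toReal / 2) :=
        add_le_add le_rfl (hN₀ n (le_of_max_le_left hn))
    _ = ε := by
        rw [← ENNReal.ofReal_add (half_pos he).le (half_pos he).le, add_halves, ENNReal.ofReal_toReal htop]

/-- Arithmetic of the deviation events: `δ < X ≤ ω(1 + Eₜ + D) + C D` with `ω(1 + Eₜ) ≤ δ/2` forces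
`δ/(2(ω + C)) ≤ D`. -/
theorem co_event_arith {δ ω C Et Dz X : ℝ} (hω0 : 0 < ω) (hC0 : 0 ≤ C) (hωδ : ω * (1 + Et) ≤ δ / 2)
    (hz : δ < X) (hb : X ≤ ω * (1 + Et + Dz) + C * Dz) : δ / (2 * (ω + C)) ≤ Dz := by
  rw [div_le_iff₀ (by positivity)]
  nlinarith

/-! ## The stub -/

/-- **S3' — the clamped box relative energy is coercive (size M–L; convex analysis + measure theory).**
Under `HsEosLowDensity` there is a band threshold `ηd > 0` such that for every band `0 < η₁ < ηd`, continuous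
positive profiles, `0 < σ ≤ 1/2` (local Gibbs laws are probability measures), every classical hard-sphere
Euler solution on `[0,T)`, every flow family, every kinetic window, every `t ∈ [0,T)` and clamps admissible on
`[0,t]`: vanishing of the mean clamped box relative energy at `t` forces `TendstoHydroFieldsAt` at `t`.
Pointwise coercivity of Březina–Feireisl's clamped energy for the cut law (`co_pointwise_estimate`:
`dev ≤ ε + K' ℰ_Z` on admissible box states; frozen boxes only below a density threshold), admissibility
`P_N`-a.s. at time `t` (`co_ae_distinctVel`: shared velocities are Liouville-null and the flow preserves
Liouville; one-particle boxes have density `((N+1)ℓ³)⁻¹ → 0`), integration in `x` and expectation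
(`co_pathwise_integral_le`, `co_tendsto_zero_of_le`), and the read-out of tested fields from box fields by
uniform continuity of `χ` plus Markov (`co_abs_density_dev_le`, `co_norm_momentum_dev_le`,
`co_abs_energy_dev_le`, `co_tendsto_measure_of_le`). -/
theorem stub_clampedRelEnergyCoercive :
    HsEosLowDensity →
      ∃ ηd : ℝ, 0 < ηd ∧ ∀ η₁ : ℝ, 0 < η₁ → η₁ < ηd →
        ∀ (a₀ θ₀ : T3 → ℝ) (u₀ : T3 → V3), Continuous a₀ → Continuous θ₀ → Continuous u₀ →
          (∀ x, 0 < a₀ x) → (∀ x, 0 < θ₀ x) →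
          ∀ σ : ℝ, 0 < σ → σ ≤ 1 / 2 →
            ∀ (T : ℝ) (ρ θ : ℝ → T3 → ℝ) (u : ℝ → T3 → V3), IsHardSphereEulerSolution σ T ρ u θ →
              ∀ Φ : (N : ℕ) → HardSphereFlow (Literature.Analysis.FluidPDE.Torus.geometry (Fin 3))
                  (hsDiameter σ N) (N + 1),
                ∀ ℓ : ℕ → ℝ, IsKineticWindow ℓ →
                  ∀ t ∈ Ico 0 T, ∀ a b : ℝ, ClampAdmissible σ η₁ a b ρ θ t →
                    BoxClampedRelEnergyVanishesAt σ η₁ a b a₀ u₀ θ₀ Φ ρ u θ ℓ t →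
                      TendstoHydroFieldsAt (fun N => localGibbsLaw σ a₀ u₀ θ₀ N (Φ N)) Φ ρ u θ t := by
  rintro ⟨η₀, hη₀, F, hF, hEq, -, -, -⟩
  obtain ⟨ηd, hηd, hηd₀, hpw⟩ := co_pointwise_estimate hη₀ hF hEq
  refine ⟨ηd, hηd, ?_⟩
  intro η₁ hη₁ hη₁d a₀ θ₀ u₀ ha hθ hu ha0 hθ0 σ hσ hσ2 T ρ θ u hsol Φ ℓ hℓ t ht a b hadm hvan
  have hη₁₀ : η₁ < η₀ := hη₁d.trans_le hηd₀
  -- the strong data at time `t`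
  have hρc : Continuous (ρ t) := (hsol.smooth_density.isSmooth_slice ht).continuous
  have huc : Continuous (u t) := (hsol.smooth_velocity.isSmooth_slice ht).continuous
  have hθc : Continuous (θ t) := (hsol.smooth_temperature.isSmooth_slice ht).continuous
  have hρt0 : ∀ x, 0 < ρ t x := hsol.density_pos t ht
  have hθt0 : ∀ x, 0 < θ t x := hsol.temperature_pos t ht
  have hμC : Continuous fun x => (cutEOS σ η₁).chemPotential (ρ t x) (θ t x) :=
    (cc_continuousOn_chemPotential hF hEq hη₁ hη₁₀ hσ).comp_continuous (hρc.prodMk hθc)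
      fun x => ⟨hρt0 x, hθt0 x⟩
  have hpC : Continuous fun x => (cutEOS σ η₁).p (ρ t x) (θ t x) :=
    tz_continuous_p hF hEq hη₁ hη₁₀ hσ hρc hθc hρt0
  have hEt0 := abs_nonneg (∫ x, totalEnergyDensity (ρ t x) (u t x) (θ t x))
  haveI hprob : ∀ N, IsProbabilityMeasure (localGibbsLaw σ a₀ u₀ θ₀ N (Φ N)) := fun N =>
    isProbabilityMeasure_localGibbsLaw ha hθ hu ha0 hθ0 hσ2 N (Φ N)
  -- the pointwise estimate at time `t`
  obtain ⟨ρs, hρs, hK'⟩ := hpw η₁ hη₁ hη₁d σ hσ T ρ θ u hsol t ht a b hadm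
  -- the `L¹(dx)` box deviation of one initial configuration
  obtain ⟨D, hD⟩ : ∃ D : (N : ℕ) → Config (N + 1) (Fin 3) T3 → ℝ, D = fun N z => ∫ x,
      (|empiricalDensityField ((Φ N).flow t z) (boxKernel (ℓ N) x) - ρ t x| +
        ‖empiricalMomentumField ((Φ N).flow t z) (boxKernel (ℓ N) x) - ρ t x • u t x‖ +
        |empiricalEnergyField ((Φ N).flow t z) (boxKernel (ℓ N) x) -
          totalEnergyDensity (ρ t x) (u t x) (θ t x)|) := ⟨_, rfl⟩
  have hD0 : ∀ N z, 0 ≤ D N z := fun N z => by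
    rw [hD]; exact integral_nonneg fun x => by positivity
  -- Step 1: the mean box deviation vanishes
  have hDlim : Tendsto (fun N => ∫⁻ z, ENNReal.ofReal (D N z) ∂(localGibbsLaw σ a₀ u₀ θ₀ N (Φ N)))
      atTop (𝓝 0) := by
    have hev : ∀ᶠ N : ℕ in atTop, ((N : ℝ) + 1)⁻¹ * (ℓ N ^ 3)⁻¹ ≤ ρs := by
      filter_upwards [hℓ.2.2.eventually_ge_atTop ρs⁻¹] with N hN
      have hpos : 0 < ℓ N ^ 3 * ((N : ℝ) + 1) := mul_pos (pow_pos (hℓ.1 N).1 3) (by positivity)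
      rw [← mul_inv_rev, inv_le_comm₀ hpos hρs]
      exact hN
    refine co_tendsto_zero_of_le hvan fun ε hε => ?_
    obtain ⟨K', hK'0, hpt⟩ := hK' ε hε
    refine ⟨ENNReal.ofReal K', ENNReal.ofReal_ne_top, ?_⟩
    filter_upwards [hev] with N hN
    calc ∫⁻ z, ENNReal.ofReal (D N z) ∂(localGibbsLaw σ a₀ u₀ θ₀ N (Φ N))
        ≤ ∫⁻ z, (ENNReal.ofReal ε + ENNReal.ofReal K' *
            ENNReal.ofReal (clampedRelEnergyObs σ η₁ a b ρ u θ N (Φ N) (ℓ N) t z))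
            ∂(localGibbsLaw σ a₀ u₀ θ₀ N (Φ N)) := by
          refine lintegral_mono_ae ((co_ae_distinctVel N (Φ N) t).mono fun z hz => ?_)
          have hpath : D N z ≤ ε + K' * clampedRelEnergyObs σ η₁ a b ρ u θ N (Φ N) (ℓ N) t z := by
            rw [hD]
            exact co_pathwise_integral_le (hℓ.1 N).1 hρc huc hθc hμC hpC hpt ((Φ N).flow t z) hz hN
          calc ENNReal.ofReal (D N z)
              ≤ ENNReal.ofReal (ε + K' * clampedRelEnergyObs σ η₁ a b ρ u θ N (Φ N) (ℓ N) t z) :=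
                ENNReal.ofReal_le_ofReal hpath
            _ ≤ ENNReal.ofReal ε +
                  ENNReal.ofReal (K' * clampedRelEnergyObs σ η₁ a b ρ u θ N (Φ N) (ℓ N) t z) :=
                ENNReal.ofReal_add_le
            _ = _ := by rw [ENNReal.ofReal_mul hK'0]
      _ = ENNReal.ofReal ε + ENNReal.ofReal K' *
            ∫⁻ z, ENNReal.ofReal (clampedRelEnergyObs σ η₁ a b ρ u θ N (Φ N) (ℓ N) t z)
              ∂(localGibbsLaw σ a₀ u₀ θ₀ N (Φ N)) := by
          rw [lintegral_add_left measurable_const, lintegral_const, measure_univ, mul_one,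
            lintegral_const_mul' _ _ ENNReal.ofReal_ne_top]
  -- Step 2: read-out of the tested fields
  intro χ hχ δ hδ
  obtain ⟨C, hC0, hC⟩ := exists_forall_abs_le_of_continuous hχ
  obtain ⟨ω, hω0, hωδ⟩ : ∃ ω : ℝ, 0 < ω ∧
      ω * (1 + |∫ x, totalEnergyDensity (ρ t x) (u t x) (θ t x)|) ≤ δ / 2 :=
    ⟨δ / (2 * (1 + |∫ x, totalEnergyDensity (ρ t x) (u t x) (θ t x)|)), by positivity,
      le_of_eq (by rw [div_mul_eq_mul_div, mul_div_mul_right _ _ (by positivity)])⟩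
  obtain ⟨ℓ₀, hℓ₀, hUC⟩ :=
    Metric.uniformContinuous_iff.1 (CompactSpace.uniformContinuous_of_continuous hχ) ω hω0
  have hevℓ : ∀ᶠ N : ℕ in atTop, ℓ N / 2 ≤ ℓ₀ := by
    filter_upwards [hℓ.2.1.eventually (gt_mem_nhds hℓ₀)] with N hN
    linarith [(hℓ.1 N).1]
  have hmod : ∀ N, ℓ N / 2 ≤ ℓ₀ → ∀ x y : T3, dist x y < ℓ N / 2 → |χ x - χ y| ≤ ω :=
    fun N hN x y hxy => by simpa only [Real.dist_eq] using (hUC (hxy.trans_le hN)).le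
  have hc0 : 0 < δ / (2 * (ω + C)) := by positivity
  refine ⟨?_, ?_, ?_⟩
  · refine co_tendsto_measure_of_le (fun N => localGibbsLaw σ a₀ u₀ θ₀ N (Φ N)) hc0 (fun N => ?_) hDlim ?_
    · exact measurableSet_lt measurable_const (continuous_abs.measurable.comp
        (((LGFS.measurable_empiricalDensityField hχ.measurable).comp ((Φ N).measurable_flow t)).sub
          measurable_const))
    · filter_upwards [hevℓ] with N hN
      refine ae_of_all _ fun z hz => ?_
      have hb : |empiricalDensityField ((Φ N).flow t z) χ - ∫ x, χ x * ρ t x| ≤ ω + C * D N z := by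
        rw [hD]
        exact co_abs_density_dev_le ((Φ N).flow t z) hχ hC0 hC (hℓ.1 N).1 (hℓ.1 N).2 (hmod N hN)
          hρc huc hθc
      exact co_event_arith hω0 hC0 hωδ hz
        (hb.trans (by linarith [mul_nonneg hω0.le hEt0, mul_nonneg hω0.le (hD0 N z)]))
  · refine co_tendsto_measure_of_le (fun N => localGibbsLaw σ a₀ u₀ θ₀ N (Φ N)) hc0 (fun N => ?_) hDlim ?_
    · exact measurableSet_lt measurable_const
        ((((LGFS.measurable_empiricalMomentumField hχ.measurable).comp ((Φ N).measurable_flow t)).sub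
          measurable_const).norm)
    · filter_upwards [hevℓ] with N hN
      refine ae_of_all _ fun z hz => ?_
      have hb : ‖empiricalMomentumField ((Φ N).flow t z) χ - ∫ x, (χ x * ρ t x) • u t x‖ ≤
          ω * (1 / 2 + |∫ x, totalEnergyDensity (ρ t x) (u t x) (θ t x)| + D N z) + C * D N z := by
        rw [hD]
        exact co_norm_momentum_dev_le ((Φ N).flow t z) hχ hC0 hC (hℓ.1 N).1 (hℓ.1 N).2 hω0.le
          (hmod N hN) hρc huc hθc
      exact co_event_arith hω0 hC0 hωδ hz (hb.trans (by linarith))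
  · refine co_tendsto_measure_of_le (fun N => localGibbsLaw σ a₀ u₀ θ₀ N (Φ N)) hc0 (fun N => ?_) hDlim ?_
    · exact measurableSet_lt measurable_const (continuous_abs.measurable.comp
        (((LGFS.measurable_empiricalEnergyField hχ.measurable).comp ((Φ N).measurable_flow t)).sub
          measurable_const))
    · filter_upwards [hevℓ] with N hN
      refine ae_of_all _ fun z hz => ?_
      have hb : |empiricalEnergyField ((Φ N).flow t z) χ -
          ∫ x, χ x * totalEnergyDensity (ρ t x) (u t x) (θ t x)| ≤
          ω * (|∫ x, totalEnergyDensity (ρ t x) (u t x) (θ t x)| + D N z) + C * D N z := by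
        rw [hD]
        exact co_abs_energy_dev_le ((Φ N).flow t z) hχ hC0 hC (hℓ.1 N).1 (hℓ.1 N).2 hω0.le
          (hmod N hN) hρc huc hθc
      exact co_event_arith hω0 hC0 hωδ hz (hb.trans (by linarith))

end Summit.AtomisticToContinuum.HydrodynamicLimit.Theorems.RES

end
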